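import Mathlib
import Summits.NavierStokesRegularity.NavierStokesRegularity.Theses.MirrorChamber
import Literature.Analysis.FluidPDE.AxisymHouLiVariables
import HarnessLib

/-!
# `MirrorChamber.ApexJet` — the apex jet of a `B₃`-equivariant divergence-free field is flat
  (route `MirrorChamber`, item stmt-NavierStokesRegularity-1600, support (H2); parity + Schur)

**Statement.** For `v : ℝ³ → ℝ³` of class `C²`, divergence free and equivariant under all 48 signed
coordinate permutations, `v 0 = 0`, `Dv(0) = 0` and `D²v(0) = 0`.

PROOF. `−I ∈ B₃` makes `v` odd, so `v(0) = 0` and `D²v(0) = 0` (the second derivative of an odd map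
is odd). `Dv(0)` commutes with every signed permutation matrix: with the sign flips it is diagonal,
with the transpositions its diagonal entries agree, so `Dv(0) = cI`, and `3c = div v(0) = 0`.

HONEST FRAMING: pointwise linear algebra about a HYPOTHETICAL equivariant field; nothing here bears on
the regularity problem itself.
-/

noncomputable section

set_option linter.dupNamespace false

namespace Summit.NavierStokesRegularity.NavierStokesRegularity.Theorems

namespace ApexJet

open Literature.Analysis Literature.Analysis.FluidPDE

/-- A signed coordinate permutation `x ↦ (εᵢ x_{σ i})ᵢ` is (the action of) a continuous linear map.
[folklore] -/
theorem exists_signedPermCLM (σ : Equiv.Perm (Fin 3)) (ε : Fin 3 → ℝ) :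
    ∃ G : EuclideanSpace ℝ (Fin 3) →L[ℝ] EuclideanSpace ℝ (Fin 3),
      ∀ x, G x = WithLp.toLp 2 (fun i => ε i * x (σ i)) :=
  ⟨LinearMap.toContinuousLinearMap
    { toFun := fun x => WithLp.toLp 2 (fun i => ε i * x (σ i))
      map_add' := fun x y => by
        ext i
        simp [mul_add]
      map_smul' := fun c x => by
        ext i
        simp [mul_left_comm] }, fun _ => rfl⟩

variable {v : EuclideanSpace ℝ (Fin 3) → EuclideanSpace ℝ (Fin 3)}

/-- **`Dv(0)` commutes with the signed permutations** (chain rule on `v ∘ g = g ∘ v`). -/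
theorem fderiv_comp_signedPerm (hv : ContDiff ℝ 2 v)
    (hequi : ∀ (σ : Equiv.Perm (Fin 3)) (ε : Fin 3 → ℝ), (∀ i, ε i = 1 ∨ ε i = -1) →
      ∀ x : EuclideanSpace ℝ (Fin 3),
        v (WithLp.toLp 2 fun i => ε i * x (σ i)) = WithLp.toLp 2 fun i => ε i * v x (σ i))
    (σ : Equiv.Perm (Fin 3)) (ε : Fin 3 → ℝ) (hε : ∀ i, ε i = 1 ∨ ε i = -1)
    (w : EuclideanSpace ℝ (Fin 3)) :
    fderiv ℝ v 0 (WithLp.toLp 2 fun i => ε i * w (σ i)) =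
      WithLp.toLp 2 fun i => ε i * (fderiv ℝ v 0 w) (σ i) := by
  obtain ⟨G, hG⟩ := exists_signedPermCLM σ ε
  have hd : Differentiable ℝ v := hv.differentiable (by norm_num)
  have hfun : v ∘ G = G ∘ v := funext fun x => by
    simp only [Function.comp_apply, hG]
    exact hequi σ ε hε x
  rw [← hG, ← hG]
  have h1 : fderiv ℝ (v ∘ G) 0 = (fderiv ℝ v 0).comp G := by
    rw [fderiv_comp 0 (hd _) G.differentiableAt, G.fderiv, map_zero]
  have h2 : fderiv ℝ (G ∘ v) 0 = G.comp (fderiv ℝ v 0) := by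
    rw [fderiv_comp 0 G.differentiableAt (hd 0), G.fderiv]
  have h := congrArg (fun L : EuclideanSpace ℝ (Fin 3) →L[ℝ] EuclideanSpace ℝ (Fin 3) => L w)
    (h1.symm.trans ((congrArg (fderiv ℝ · 0) hfun).trans h2))
  simpa using h

/-- **The apex is a flat critical point of `Dv`**: `Dv(0) = 0` (Schur + trace). -/
theorem fderiv_zero_eq_zero (hv : ContDiff ℝ 2 v) (hdiv : VectorCalculus.IsDivFree v)
    (hequi : ∀ (σ : Equiv.Perm (Fin 3)) (ε : Fin 3 → ℝ), (∀ i, ε i = 1 ∨ ε i = -1) →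
      ∀ x : EuclideanSpace ℝ (Fin 3),
        v (WithLp.toLp 2 fun i => ε i * x (σ i)) = WithLp.toLp 2 fun i => ε i * v x (σ i)) :
    fderiv ℝ v 0 = 0 := by
  set A := fderiv ℝ v 0 with hA
  -- matrix entries `a i j = (A eⱼ)ᵢ`
  -- (i) off-diagonal entries vanish: flip the sign of coordinate `i`
  have hoff : ∀ i j : Fin 3, i ≠ j → A (EuclideanSpace.single j 1) i = 0 := by
    intro i j hij
    set ε : Fin 3 → ℝ := fun k => if k = i then -1 else 1 with hε
    have hε' : ∀ k, ε k = 1 ∨ ε k = -1 := fun k => by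
      by_cases hk : k = i <;> simp [hε, hk]
    have hGe : (WithLp.toLp 2 fun k => ε k * (EuclideanSpace.single j (1 : ℝ)) ((1 : Equiv.Perm (Fin 3)) k))
        = EuclideanSpace.single j 1 := by
      ext k
      rw [PiLp.toLp_apply, Equiv.Perm.coe_one, id]
      by_cases hkj : k = j
      · subst hkj
        simp [hε, hij.symm]
      · simp [hkj]
    have h := fderiv_comp_signedPerm hv hequi 1 ε hε' (EuclideanSpace.single j 1)
    rw [hGe] at h
    have hi := congrArg (fun w : EuclideanSpace ℝ (Fin 3) => w i) h
    simp only [Equiv.Perm.coe_one, id, hε, if_true] at hi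
    linarith
  -- (ii) diagonal entries agree: swap coordinates `i` and `j`
  have hdiag : ∀ i j : Fin 3, A (EuclideanSpace.single j 1) j = A (EuclideanSpace.single i 1) i := by
    intro i j
    have hε' : ∀ k : Fin 3, (fun _ : Fin 3 => (1 : ℝ)) k = 1 ∨ (fun _ : Fin 3 => (1 : ℝ)) k = -1 :=
      fun _ => Or.inl rfl
    have hGe : (WithLp.toLp 2 fun k => (fun _ : Fin 3 => (1 : ℝ)) k *
        (EuclideanSpace.single i (1 : ℝ)) (Equiv.swap i j k)) = EuclideanSpace.single j 1 := by
      ext k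
      rw [PiLp.toLp_apply, one_mul]
      by_cases hkj : k = j
      · subst hkj
        simp
      · by_cases hki : k = i
        · subst hki
          simp [Equiv.swap_apply_left, Ne.symm hkj, hkj]
        · simp [Equiv.swap_apply_of_ne_of_ne hki hkj, hki, hkj]
    have h := fderiv_comp_signedPerm hv hequi (Equiv.swap i j) (fun _ => 1) hε'
      (EuclideanSpace.single i 1)
    rw [hGe] at h
    have hj := congrArg (fun w : EuclideanSpace ℝ (Fin 3) => w j) h
    simp only [one_mul, Equiv.swap_apply_right] at hj
    exact hj
  -- (iii) the trace vanishes
  have htr := hdiv 0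
  rw [divergence_eq_sum_three] at htr
  have h00 : A (EuclideanSpace.single 0 1) 0 = 0 := by
    have h1 := hdiag 0 1
    have h2 := hdiag 0 2
    simp only [hA] at h1 h2 ⊢
    linarith
  have hdiag0 : ∀ j : Fin 3, A (EuclideanSpace.single j 1) j = 0 := fun j => by
    rw [hdiag 0 j]; exact h00
  have hcol : ∀ j : Fin 3, A (EuclideanSpace.single j 1) = 0 := by
    intro j
    ext i
    by_cases hij : i = j
    · subst hij
      simpa using hdiag0 i
    · simpa using hoff i j hij
  -- conclude on the standard basis
  refine ContinuousLinearMap.ext fun x => ?_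
  rw [← (EuclideanSpace.basisFun (Fin 3) ℝ).sum_repr x, map_sum]
  simp [map_smul, hcol]

/-- **`−I ∈ B₃` makes `v` odd.** -/
theorem neg_apply_eq
    (hequi : ∀ (σ : Equiv.Perm (Fin 3)) (ε : Fin 3 → ℝ), (∀ i, ε i = 1 ∨ ε i = -1) →
      ∀ x : EuclideanSpace ℝ (Fin 3),
        v (WithLp.toLp 2 fun i => ε i * x (σ i)) = WithLp.toLp 2 fun i => ε i * v x (σ i))
    (x : EuclideanSpace ℝ (Fin 3)) : v (-x) = -v x := by
  have h := hequi 1 (fun _ => -1) (fun _ => Or.inr rfl) x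
  have e1 : (WithLp.toLp 2 fun i => (-1 : ℝ) * x ((1 : Equiv.Perm (Fin 3)) i)) = -x := by
    ext i
    simp
  have e2 : (WithLp.toLp 2 fun i => (-1 : ℝ) * v x ((1 : Equiv.Perm (Fin 3)) i)) = -v x := by
    ext i
    simp
  rw [e1, e2] at h
  exact h

/-- **`v(0) = 0`.** -/
theorem apply_zero_eq_zero
    (hequi : ∀ (σ : Equiv.Perm (Fin 3)) (ε : Fin 3 → ℝ), (∀ i, ε i = 1 ∨ ε i = -1) →
      ∀ x : EuclideanSpace ℝ (Fin 3),
        v (WithLp.toLp 2 fun i => ε i * x (σ i)) = WithLp.toLp 2 fun i => ε i * v x (σ i)) :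
    v 0 = 0 := by
  have h := neg_apply_eq hequi 0
  rw [neg_zero] at h
  -- `v 0 = -v 0`
  have h2 : (2 : ℝ) • v 0 = 0 := by rw [two_smul]; nth_rewrite 2 [h]; exact add_neg_cancel _
  exact (smul_eq_zero.1 h2).resolve_left two_ne_zero

/-- **`D²v(0) = 0`** (the second derivative of an odd `C²` map is odd). -/
theorem iteratedFDeriv_two_zero_eq_zero (hv : ContDiff ℝ 2 v)
    (hequi : ∀ (σ : Equiv.Perm (Fin 3)) (ε : Fin 3 → ℝ), (∀ i, ε i = 1 ∨ ε i = -1) →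
      ∀ x : EuclideanSpace ℝ (Fin 3),
        v (WithLp.toLp 2 fun i => ε i * x (σ i)) = WithLp.toLp 2 fun i => ε i * v x (σ i)) :
    iteratedFDeriv ℝ 2 v 0 = 0 := by
  set N : EuclideanSpace ℝ (Fin 3) →L[ℝ] EuclideanSpace ℝ (Fin 3) :=
    -ContinuousLinearMap.id ℝ (EuclideanSpace ℝ (Fin 3)) with hN
  have hcomp : v ∘ N = -v := funext fun x => by
    simp only [Function.comp_apply, hN, neg_apply, ContinuousLinearMap.id_apply,
      Pi.neg_apply]
    exact neg_apply_eq hequi x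
  have h2 := N.iteratedFDeriv_comp_right hv 0 (i := 2) le_rfl
  rw [hcomp, iteratedFDeriv_neg_apply] at h2
  have hN0 : N 0 = 0 := map_zero N
  rw [hN0] at h2
  -- evaluate at `m`: `-D m = D (-m) = D m`
  ext m i
  have h3 := congrArg (fun M : ContinuousMultilinearMap ℝ (fun _ : Fin 2 => EuclideanSpace ℝ (Fin 3))
      (EuclideanSpace ℝ (Fin 3)) => M m) h2
  simp only [neg_apply, ContinuousMultilinearMap.compContinuousLinearMap_apply, hN,
    ContinuousLinearMap.id_apply] at h3
  have h4 : (iteratedFDeriv ℝ 2 v 0) (fun j => -(m j)) = (iteratedFDeriv ℝ 2 v 0) m := by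
    have h5 := (iteratedFDeriv ℝ 2 v 0).map_smul_univ (fun _ => (-1 : ℝ)) m
    simp only [neg_one_smul, Finset.prod_const, Finset.card_univ, Fintype.card_fin] at h5
    rw [h5]
    norm_num
  rw [h4] at h3
  -- `h3 : -D m = D m`
  have h6 : (2 : ℝ) • (iteratedFDeriv ℝ 2 v 0) m = 0 := by
    rw [two_smul]; nth_rewrite 1 [← h3]; exact neg_add_cancel _
  have h7 : (iteratedFDeriv ℝ 2 v 0) m = 0 := (smul_eq_zero.1 h6).resolve_left two_ne_zero
  rw [h7]
  rfl

end ApexJet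

open ApexJet in
/-- **Item stmt-NavierStokesRegularity-1600** (`MirrorChamber.ApexJet`): the apex jet of a `C²`,
divergence-free, `B₃`-equivariant field is flat: `v 0 = 0`, `Dv(0) = 0`, `D²v(0) = 0`. [this file] -/
theorem mirrorChamber_apexJet_proof :
    Summit.NavierStokesRegularity.NavierStokesRegularity.Theses.MirrorChamber.ApexJet := by
  unfold Summit.NavierStokesRegularity.NavierStokesRegularity.Theses.MirrorChamber.ApexJet
  intro v hv hdiv hequi
  exact ⟨apply_zero_eq_zero hequi, fderiv_zero_eq_zero hv hdiv hequi,
    iteratedFDeriv_two_zero_eq_zero hv hequi⟩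

end Summit.NavierStokesRegularity.NavierStokesRegularity.Theorems

end
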